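import Mathlib.CategoryTheory.Comma.Over.Basic
import Mathlib.CategoryTheory.Adjunction.Basic
import Literature.AnabelianGeometry.EtaleTheta.TemperedFrobenioid

/-!
# [EtTh] §3, part 5: Example 3.9 "Theta Functions and Tempered Frobenioids"

Source: [MochizukiEtTh2009] §3, Example 3.9 (i)–(iv), PDF pp. 83–85 (printed 309–311). Locators
`p.N` = PDF page. This is the most-cited item of §3 in [IUTchI–IV] ("the tempered Frobenioid of
[EtTh], Example 3.9", [IUTchI] Examples 3.2–3.5).

ERRATUM E3 ([IUTchI] Rmk 3.2.4 (vi) (1)–(3), kurims p.77, read on the page): (1) in (i) "the phrase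
'`Y^log` is of genus 1' should be replaced by '`Y^log` is of genus 1 and has either precisely one cusp
or precisely two cusps whose difference is a 2-torsion element of the underlying elliptic curve'";
(2) in (i) the lower arrow of the diagram in the example "`Ẋ^log → Ċ^log`" is to be read without
underlines; (3) in (ii) "'unramified over the cusps of …' should be replaced by 'unramified over the
cusps as well as over the generic points of the irreducible components of the special fibers of the
stable models of …'" and "'tempered coverings' → 'tempered admissible coverings'". "In a word, …
the monoid '`Φ_W^ell`' is to be defined to be just large enough to include precisely those divisors
which are necessary in order to treat the theta functions that appear in [EtTh]." The printed text is
typed; the errata are recorded in the docstrings of the fields concerned.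

## How Example 3.9 is typed

(i)–(ii) are DATA: four categories `D_U, D_X, D_Y, D_W` ("`:= B^temp(-)⁰`") with the four functors and
a 1-commutativity isomorphism, the full subcategories `D_Y^ell ⊆ D_Y`, `D_W^ell ⊆ D_W` with their left
adjoints. (iii) the monoid `Φ_W^ell ⊆ Φ_W` on `D_W` is DATA (a `SubMonoidOn` of `Φ_W^ℝ`, the realified
divisor data of Def 3.6 (i) for `W`), its printed properties are hypothesis fields. (iv) is REAL on top
of that: for `α : A → B` in `D_W` the category `D_α := (D_W)_B[α]` is Mathlib's `Over B` cut down by the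
§0 bracket construction, `Φ_α^ell := Φ_W^ell|_{D_α}` is the restriction, and the conclusion "gives
rise to a tempered Frobenioid … of rationally standard type with perfect divisor monoid over the slim
base category `D_α` of FSM-type" is the term `Example39.thetaFrobenioid` of type `TemperedFrobenioid`
(Def 3.6 (ii)) assembled from the hypothesis fields, plus named facts. The curves themselves
(Def 2.5: `X, C, X̲, C̲, Ẋ, Ċ, Ẋ̲, Ċ̲`, seat abc-iut-L2-t2; the theta functions of §1, seat abc-iut-L2-t1)
enter only through docstrings: nothing here asserts their existence.
-/

namespace Literature.AnabelianGeometry.EtaleTheta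

open CategoryTheory Opposite Literature.AlgebraicGeometry.Frobenioids

universe u v w

/-! ## Restriction of a subfunctor in monoids along a functor (for `Φ_W^ell|_{D_α}`) -/

namespace SubMonoidOn

variable {D : Type u} [Category.{v} D] {D' : Type*} [Category D'] {Ψ : Dᵒᵖ ⥤ CommMonCat.{w}}

/-- Restriction `Φ|_{D'}` of a subfunctor in monoids along a functor `G : D' → D` (the operation
"`|_{D_α}`", "`|_{D_W}`" of Example 3.9 (iii), (iv), pp.84–85). [cite: MochizukiEtTh2009, Ex 3.9 p.85] -/
def restrict (S : SubMonoidOn Ψ) (G : D' ⥤ D) : SubMonoidOn (G.op ⋙ Ψ) where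
  carrier A := S.carrier (G.op.obj A)
  map_mem f x hx := S.map_mem (G.op.map f) x hx

end SubMonoidOn

/-! ## Example 3.9 (i)–(iii): the data -/

variable (V : FrdIMonoidStub.{w})

/-- **Example 3.9 (i)–(iii)** (pp.83–84) as data. (i) "`X^log` is a smooth log orbicurve of the sort
defined in Definition 2.5, (i), (ii) [i.e., one of `X, C, X̲, C̲, Ẋ, Ċ, Ẋ̲, Ċ̲`]. Then there exists a
[1-]commutative diagram of finite log étale Galois coverings of smooth log orbicurves
`U^log → X^log`, `U^log → Y^log`, `X^log → W^log`, `Y^log → W^log` — where `U^log, Y^log` are smooth log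
curves …; the diagram induces a natural isomorphism `Gal(U^log/X^log) ≅ Gal(Y^log/W^log)`; the order of
[this group] is `≤ 2`; `Y^log → W^log` is unramified at the cusps of `Y^log`; `Y^log` is of genus 1"
(E3 (1): "… and has either precisely one cusp or precisely two cusps whose difference is a 2-torsion
element"); "`D_U := B^temp(U^log)⁰`; `D_X := B^temp(X^log)⁰ (= D₀)`; `D_Y := …`; `D_W := …`" with the
induced functors. (ii) "`D_Y^ell ⊆ D_Y`; `D_W^ell ⊆ D_W` … the full subcategories of tempered coverings that
are unramified over the cusps" (E3 (3): "… as well as over the generic points of the irreducible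
components of the special fibers of the stable models"; "tempered admissible coverings"), "by taking the
left adjoints to the natural inclusion functors … we obtain natural functors `D_Y → D_Y^ell`,
`D_W → D_W^ell` [cf. [FrdII], Example 1.3, (ii)]". (iii) "`Φ_W` the monoid on `D_W` given by forming the
perfection of the monoid '`Φ₀`' of Definition 3.3, (iii), for some choice of tempered filter on `W^log`
that arises from a tempered filter on `Y^log`"; "`Φ^ell_{W^ell}(A)` … the perf-saturation in `Φ_W(A)` of
the submonoid `lim Div⁺(Z^log_∞)^{Gal(Z^log_∞/A)}`" over the universal combinatorial coverings in `D_W^ell`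
with stable split reduction; "`Φ_W^ell := Φ^ell_{W^ell}|_{D_W} ⊆ Φ_W`"; "`Φ_W^ell` is a perfect and
group-saturated submonoid of … `Φ_W` …, perf-factorial, non-dilating, and cuspidally pure … independent,
up to natural isomorphism, of the choice of tempered filter". Here `Φ_W^ell` is a subfunctor of the
realified data `Φ_W^ℝ` (Def 3.6 (i)) and its printed properties are hypothesis fields.
[cite: MochizukiEtTh2009, Ex 3.9 p.83] -/
structure Example39Data (DW : Type u) [Category.{v} DW] (TW : RealifiedDivisorMonoids (D₀ := DW) V) :
    Type (max u v w + 2) where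
  /-- `D_U := B^temp(U^log)⁰` -/
  DU : Type u
  /-- `D_X := B^temp(X^log)⁰ (= D₀)` -/
  DX : Type u
  /-- `D_Y := B^temp(Y^log)⁰` -/
  DY : Type u
  /-- category structures -/
  [instU : Category.{v} DU]
  /-- category structures -/
  [instX : Category.{v} DX]
  /-- category structures -/
  [instY : Category.{v} DY]
  /-- `D_U → D_X` (from `U^log → X^log`) -/
  fUX : DU ⥤ DX
  /-- `D_U → D_Y` (from `U^log → Y^log`) -/
  fUY : DU ⥤ DY
  /-- `D_X → D_W` (from `X^log → W^log`) -/
  fXW : DX ⥤ DW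
  /-- `D_Y → D_W` (from `Y^log → W^log`) -/
  fYW : DY ⥤ DW
  /-- the diagram is 1-commutative -/
  oneComm : fUX ⋙ fXW ≅ fUY ⋙ fYW
  /-- `D_Y^ell ⊆ D_Y`: "tempered coverings … unramified over the cusps of `Y^log`" (E3 (3): tempered
  admissible coverings, unramified also over the generic points of the special-fibre components) -/
  ellY : ObjectProperty DY
  /-- `D_W^ell ⊆ D_W`, likewise -/
  ellW : ObjectProperty DW
  /-- the left adjoint `D_Y → D_Y^ell` of the inclusion -/
  toEllY : DY ⥤ ellY.FullSubcategory
  /-- adjunction `(D_Y → D_Y^ell) ⊣ (D_Y^ell ⊆ D_Y)` -/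
  adjY : toEllY ⊣ ellY.ι
  /-- the left adjoint `D_W → D_W^ell` of the inclusion -/
  toEllW : DW ⥤ ellW.FullSubcategory
  /-- adjunction `(D_W → D_W^ell) ⊣ (D_W^ell ⊆ D_W)` -/
  adjW : toEllW ⊣ ellW.ι
  /-- (iii) `Φ_W^ell ⊆ Φ_W (⊆ Φ_W^ℝ)`, the theta-relevant divisors, a subfunctor in monoids on `D_W` -/
  ΦellW : SubMonoidOn TW.ΦR
  /-- (iii) "`Φ_W^ell` is a perfect … submonoid" ([FrdI] §0; tree `IsPerfect`) -/
  isPerfect : ∀ A : DWᵒᵖ, IsPerfect (ΦellW.carrier A)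
  /-- (iii) "… and [manifestly — cf. Remark 3.6.1] group-saturated submonoid of the monoid `Φ_W`" (here:
  in `Φ_W^ℝ(A)`, §0) -/
  isGroupSaturated : ∀ A : DWᵒᵖ, IsGroupSaturated (ΦellW.carrier A)
  /-- (iii) "perf-factorial" ([FrdI] Def 2.4 (i)) -/
  isPerfFactorial : ∀ A : DWᵒᵖ, V.IsPerfFactorial (ΦellW.carrier A)
  /-- (iii) "non-dilating [cf. Proposition 3.4, (i) …]" on the endomorphisms induced by endomorphisms -/
  isNonDilating : ∀ (A : DWᵒᵖ) (f : A ⟶ A), V.IsNonDilating (ΦellW.carrier A) (ΦellW.pull f)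

namespace Example39Data

attribute [instance] Example39Data.instU Example39Data.instX Example39Data.instY

variable {V} {DW : Type u} [Category.{v} DW] {TW : RealifiedDivisorMonoids (D₀ := DW) V}
  (E : Example39Data V DW TW)

/-- The second 1-commutative diagram of (ii) (p.83): `D_Y^ell → D_Y → D_W` versus `D_Y^ell → D_W^ell → D_W`,
i.e. `Y → W` carries cusp-unramified coverings to cusp-unramified coverings — "[since `Y^log → W^log`
is unramified at the cusps of `Y^log`]" (p.84). Named `Prop`. [cite: MochizukiEtTh2009, Ex 3.9 p.83] -/
def ellCompatible : Prop := ∀ A : E.DY, E.ellY A → E.ellW (E.fYW.obj A)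

/-! ## Example 3.9 (iv) (p.85): the categories `D_α` and the tempered Frobenioids -/

variable {A B : DW} (α : A ⟶ B)

/-- **Example 3.9 (iv)** (p.85): "`D_α := (D_W)_B[α] (⊆ (D_W)_B)` — where we regard `α` as an object of
`(D_W)_B`" (§0: `C_A = Over A`, `C[A]` = objects admitting a morphism to `A`). "Thus, `D_α` is a
quasi-temperoid [cf. [SemiAnbd], Definition A.1, (ii)]." [cite: MochizukiEtTh2009, Ex 3.9 p.85] -/
abbrev Dα : Type (max u v) := bracketCat (Over.mk α)

/-- "Note that we have a natural functor `D_α → D_W`" (p.85): forget the structure morphism to `B`.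
[cite: MochizukiEtTh2009, Ex 3.9 p.85] -/
def toDW : Dα α ⥤ DW := (admitsMorphismTo (Over.mk α)).ι ⋙ Over.forget B

/-- "we observe that `D_W, D_X, D_Y, D_U` are special cases of '`D_α`' [obtained by taking '`α`' to be the
identity morphism …]" (p.85): for `α = 𝟙 B`, every object of `(D_W)_B` admits a morphism to `𝟙_B`, so
`D_{𝟙 B} = (D_W)_B`. [cite: MochizukiEtTh2009, Ex 3.9 p.85] -/
theorem admitsMorphismTo_mk_id (B : DW) (Y : Over B) : admitsMorphismTo (Over.mk (𝟙 B)) Y :=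
  ⟨Over.homMk Y.hom (by exact Category.comp_id _)⟩

/-- **Example 3.9 (iv)** (p.85): "`Φ_α^ell := Φ_W^ell|_{D_α} (⊆ Φ_W|_{D_α})` … obtained simply by restricting
the functor `Φ_W^ell` via [`D_α → D_W`]". [cite: MochizukiEtTh2009, Ex 3.9 p.85] -/
def Φα : SubMonoidOn ((toDW α).op ⋙ TW.ΦR) := E.ΦellW.restrict (toDW α)

/-- `Φ_α^ell` "is perfect" (p.85) — inherited from `Φ_W^ell` objectwise.
[cite: MochizukiEtTh2009, Ex 3.9 p.85] -/
theorem isPerfect_Φα (X : (Dα α)ᵒᵖ) : IsPerfect ((E.Φα α).carrier X) := E.isPerfect _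

/-- `Φ_α^ell` is "group-saturated" (p.85) — inherited objectwise. [cite: MochizukiEtTh2009, Ex 3.9 p.85] -/
theorem isGroupSaturated_Φα (X : (Dα α)ᵒᵖ) : IsGroupSaturated ((E.Φα α).carrier X) :=
  E.isGroupSaturated _

/-- `Φ_α^ell` is "perf-factorial" (p.85) — inherited objectwise. [cite: MochizukiEtTh2009, Ex 3.9 p.85] -/
theorem isPerfFactorial_Φα (X : (Dα α)ᵒᵖ) : V.IsPerfFactorial ((E.Φα α).carrier X) :=
  E.isPerfFactorial _

/-- The remaining conditions of Definition 3.6 (ii) for `(D_α, Φ_α^ell)`, which the text asserts on p.85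
("it follows immediately from the above discussion … cuspidally pure … rational … gives rise to a
tempered Frobenioid"): `D_α` connected and totally epimorphic, `Φ_α^ell` a divisorial monoid on `D_α`,
(a) `Φ^{bs-fld}` monoprime, (b) nonzero constants. Hypothesis structure (the divisoriality / (a) / (b)
verifications use the structure of the universal combinatorial coverings, pp.84–85).
[cite: MochizukiEtTh2009, Ex 3.9 p.85] -/
structure FrobenioidHyp (VD : FrdICatStub.{max u v, v, w} (Dα α)) : Prop where
  /-- `D_α` is connected -/
  isConnected : IsConnected (Dα α)
  /-- `D_α` is totally epimorphic -/
  isTotallyEpimorphic : IsTotallyEpimorphic (Dα α)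
  /-- `Φ_α^ell` is a divisorial monoid on `D_α` -/
  isDivisorialOn : VD.IsDivisorialOn (E.Φα α).toFunctor
  /-- (a) `Φ_α^{ell,bs-fld}(X)` is monoprime -/
  isMonoprime_bsFld : ∀ X : (Dα α)ᵒᵖ, IsMonoprime
    ↥((E.Φα α).carrier X ⊓
      (TW.cnstR (op ((toDW α).obj (unop X)))).toSubmonoid.comap Algebra.GrothendieckGroup.of)
  /-- (b) nonzero constants -/
  exists_FΛ_div_ne : ∀ X : (Dα α)ᵒᵖ, ∃ b ∈ TW.FΛ (op ((toDW α).obj (unop X))),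
    ∃ x ∈ (E.Φα α).carrier X, ∃ y ∈ (E.Φα α).carrier X, x ≠ y ∧
      TW.divΛ _ b = Algebra.GrothendieckGroup.of x / Algebra.GrothendieckGroup.of y

/-- **Example 3.9 (iv)**, conclusion (p.85): "This monoid `Φ_α^ell` … gives rise to a tempered Frobenioid
[cf. Definition 3.6, (ii); Remark 3.6.6]" — the tempered Frobenioid structure on `(D_α → D_W, Φ_α^ell)`
in the sense of `TemperedFrobenioid` (Def 3.6 (ii)). [cite: MochizukiEtTh2009, Ex 3.9 p.85] -/
def thetaFrobenioid {VD : FrdICatStub.{max u v, v, w} (Dα α)} (h : E.FrobenioidHyp α VD) :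
    TemperedFrobenioid TW (Dα α) VD where
  isConnected := h.isConnected
  isTotallyEpimorphic := h.isTotallyEpimorphic
  base := toDW α
  Φ := E.Φα α
  isGroupSaturated := E.isGroupSaturated_Φα α
  isPerfFactorial := E.isPerfFactorial_Φα α
  isDivisorialOn := h.isDivisorialOn
  isMonoprime_bsFld := h.isMonoprime_bsFld
  exists_FΛ_div_ne := h.exists_FΛ_div_ne

/-- **Example 3.9 (iv)** (p.85): "the existence of the theta functions discussed in §1 [cf. especially
… Proposition 1.4, (i)] implies that the monoid `Φ_α^ell` is also rational", and the tempered Frobenioid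
is "of rationally standard type with perfect divisor monoid over the slim [cf. Remark 3.7.2] base category
`D_α` of FSM-type [cf. Remark 3.7.2]" — the parts expressible now: rationality (vocabulary `VD`), slimness
and FSM-type of `D_α` (tree). Named `Prop`. [cite: MochizukiEtTh2009, Ex 3.9 p.85] -/
def Example39_iv_facts {VD : FrdICatStub.{max u v, v, w} (Dα α)} (h : E.FrobenioidHyp α VD) : Prop :=
  (E.thetaFrobenioid α h).IsRational ∧ IsSlim (Dα α) ∧ IsOfFSMType (Dα α)

/-- `Φ_α^ell` is "cuspidally pure" (p.85; Def 3.6 (v)), for the resulting tempered Frobenioid. Named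
`Prop` (its verification uses "the well-known structure of the special fibers of the 'universal
combinatorial coverings'", p.84). [cite: MochizukiEtTh2009, Ex 3.9 p.85] -/
def Example39_iv_cuspidallyPure {VD : FrdICatStub.{max u v, v, w} (Dα α)} (h : E.FrobenioidHyp α VD) :
    Prop :=
  (E.thetaFrobenioid α h).IsCuspidallyPure

end Example39Data

end Literature.AnabelianGeometry.EtaleTheta
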